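import Summits.SmoothPoincare4.SmoothPoincare4.Theorems.ConvexBisectionAcyclicBisectionExistsEOneCurveSeparation
import Summits.SmoothPoincare4.SmoothPoincare4.Theorems.ConvexBisectionAcyclicBisectionExistsEOneCurveSheetLoop
import Summits.SmoothPoincare4.SmoothPoincare4.Theorems.ConvexBisectionAcyclicBisectionExistsCrossingStdSymp
import HarnessLib

/-!
# The `e_1`-curve pairs to zero with every chain vector except `chainVec g 3`
(wave 7, brick H5-3 of the last geometric input (R-E1CURVE) of node N3a `node_STcurve` of stub
`stub_STgeo` = NF4 N3, line `modp-braid-orbits`, crux `ConvexBisection.AcyclicBisectionExists`,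
item stmt-SmoothPoincare4-10508; registered sub-goal `helper_eOne_zero_pairings`)

The shadow of a page loop `K` of `page g 1` is read through CROSSING NUMBERS with Y4's explicit
model chain: the charts `ψ_m = baseRot g (m+1) ∘ cycleChart` (Joukowski annulus over the chord
`[ζ_m, ζ_{m+1}]`, `helper_cycleChart`, `helper_chart_baseRot`) have cores of shadow `chainVec g m`
(`helper_shadow_baseRot_cycleCore`), so `crossingNumber (ψ_m) K = stdSymp (chainVec g m) (shadow K)`
(`crossingNumber_eq_stdSymp`, X7).  For a loop whose `x`-coordinate runs on the round four-point
circle `λ (c₀ + R e^{2πiτ})` (the core of `eoChart`) all these crossing numbers VANISH for `m ≠ 3`: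
the closed collar of `ψ_m` projects to within `σ/(4(2g+1)) ≤ σ²/8` of the chord `[ζ_m, ζ_{m+1}]`
(`exists_chord_near_jX`) while the circle stays farther than `σ²/8` from it
(`helper_eOne_separation`), so the loop never meets the collar (`crossingNumber_eq_zero_of_not_mem_collar`).
Hence `stdSymp (chainVec g i) (shadow K) = 0` for all `i < 2g`, `i ≠ 3` (`helper_eOne_zero_pairings`).
Everything is proved; no `sorry`.  References: B. Farb, D. Margalit, *A primer on mapping class
groups* (2012), §6.1 [FarbMargalit2012]; J. Milnor, *Singular points of complex hypersurfaces* (1968),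
§9 [Milnor1968].
-/

noncomputable section

set_option linter.dupNamespace false

open scoped Manifold ContDiff Topology ComplexConjugate Real
open Set Function Metric Complex
open Literature.Topology.FourManifolds Literature.Topology.FourManifolds.LefschetzBase
  Literature.Topology.FourManifolds.TorusKnotMilnor Literature.GroupTheory.CombinatorialGroupTheory.SignedHurwitz

namespace Summit.SmoothPoincare4.SmoothPoincare4.Theorems.AcyclicBisectionExists.ModpBraidOrbits

variable {g : ℕ} {K : sphere (0 : EuclideanSpace ℝ (Fin 2)) 1 → Base g}

/-! ## §1 The round loop misses the collars of the model charts `ψ_m`, `m ≠ 3` -/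

/-- **A point of the closed collar of `ψ_m = baseRot (m+1) ∘ cycleChart` projects to within
`σ²/8` of the chord `[ζ_m, ζ_{m+1}]`**: its `x`-coordinate is `λ x'` with
`‖x' − chordX g m s‖ ≤ σ²/8` for some `s ∈ [0, 1]`. [folklore] -/
theorem collar_baseRot_near_chord (hg : 1 ≤ g) (m : ℕ) {q : Base g}
    (hq : q ∈ (baseRot g (m + 1) ∘ cycleChart hg norm_one_le_one'') '' (univ ×ˢ Icc (-(1 / 2) : ℝ) (1 / 2))) :
    ∃ x' : ℂ, cx q.1 = scaleX g 1 * x' ∧ ∃ s ∈ Icc (0 : ℝ) 1, ‖x' - chordX g m s‖ ≤ shalf g ^ 2 / 8 := by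
  obtain ⟨p, ⟨-, hp⟩, rfl⟩ := hq
  refine ⟨rootU (2 * g + 1) ^ (m + 1) * jX g (tParam g p), ?_, ?_⟩
  · simp only [comp_apply, baseRot_val, cx_rotAmbL, cycleChart_val, cycleAmb, cx_pagePt]; ring
  · obtain ⟨s, hs, hd⟩ := exists_chord_near_jX hg (one_lt_norm_tParam g p).le
    refine ⟨s, hs, ?_⟩
    rw [← chordX_add_period, show m + (2 * g + 1) = 2 * g + (m + 1) by ring, ← rootU_pow_mul_chordX,
      ← mul_sub, norm_mul, norm_pow, norm_rootU, one_pow, one_mul]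
    refine hd.trans (le_trans ?_ (shalf_div_le hg))
    refine mul_le_mul_of_nonneg_left ?_ (shalf_pos hg).le
    have := radP_le g p.2
    rw [norm_tParam]; linarith

/-- **The round four-point loop misses the closed collar of `ψ_m` for `m ≤ 2` or `4 ≤ m ≤ 2g − 1`.**
[folklore] -/
theorem eoLoop_not_mem_collar (hg : 2 ≤ g)
    (hKx : ∀ τ : ℝ, cx (K (circlePt τ)).1 = scaleX g 1 * (eoCenter g + eoRad g * cexp (((2 * π * τ : ℝ) : ℂ) * I)))
    {m : ℕ} (hm : m ≤ 2 ∨ (4 ≤ m ∧ m + 2 ≤ 2 * g + 1)) (τ : ℝ) :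
    K (circlePt τ) ∉ (baseRot g (m + 1) ∘ cycleChart (by omega : 1 ≤ g) norm_one_le_one'') ''
      (univ ×ˢ Icc (-(1 / 2) : ℝ) (1 / 2)) := fun hq => by
  obtain ⟨x', hx', s, hs, hd⟩ := collar_baseRot_near_chord (by omega : 1 ≤ g) m hq
  rw [hKx τ] at hx'
  have e := mul_left_cancel₀ (scaleX_ne_zero norm_one_le_one'') hx'
  have hcirc : ‖eoCenter g + eoRad g * cexp (((2 * π * τ : ℝ) : ℂ) * I) - eoCenter g‖ = eoRad g := by
    rw [add_sub_cancel_left, norm_mul, Complex.norm_real, Complex.norm_exp_ofReal_mul_I, mul_one,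
      Real.norm_eq_abs, abs_of_nonneg (eoRad_nonneg g)]
  have hsep := helper_eOne_separation g hg m hm _ hcirc s hs
  rw [e] at hsep
  linarith

/-- **The crossing number of the round loop with `ψ_m` vanishes** (`m ≤ 2` or `4 ≤ m ≤ 2g − 1`).
[cite: FarbMargalit2012, §6.1] -/
theorem crossingNumber_model_eoLoop_eq_zero (hg : 2 ≤ g)
    (hKx : ∀ τ : ℝ, cx (K (circlePt τ)).1 = scaleX g 1 * (eoCenter g + eoRad g * cexp (((2 * π * τ : ℝ) : ℂ) * I)))
    {m : ℕ} (hm : m ≤ 2 ∨ (4 ≤ m ∧ m + 2 ≤ 2 * g + 1)) :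
    crossingNumber (baseRot g (m + 1) ∘ cycleChart (by omega : 1 ≤ g) norm_one_le_one'') K = 0 :=
  crossingNumber_eq_zero_of_not_mem_collar fun τ => eoLoop_not_mem_collar hg hKx hm τ

/-! ## §2 The pairings with the chain vectors -/

/-- **`stdSymp (chainVec g m) (shadow K) = crossingNumber (ψ_m) K`** for every page loop `K` of
`page g 1` and `m < 2g` (the model chart `ψ_m` with its core of shadow `chainVec g m`).
[cite: FarbMargalit2012, Prop. 6.3] -/
theorem stdSymp_chainVec_shadow_eq_crossingNumber (hg : 1 ≤ g) (hK : Continuous K) (hKc : ∀ θ, K θ ∈ page g 1)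
    {m : ℕ} (hm : m < 2 * g) :
    stdSymp ℤ g (chainVec g m) (shadow g K hK) =
      crossingNumber (baseRot g (m + 1) ∘ cycleChart hg norm_one_le_one'') K := by
  obtain ⟨b, hb, h1, h2, h3, h4, h5, h6⟩ := helper_cycleChart g 1 hg norm_one_le_one''
  have hbm : Continuous (baseRot g (m + 1) ∘ b) := (continuous_baseRot g _).comp hb
  obtain ⟨r1, r2, r3, r4, r5, r6⟩ := helper_chart_baseRot g (m + 1) 1 b (cycleChart hg norm_one_le_one'') h1 h2 h3 h4 h5 h6
  rw [crossingNumber_eq_stdSymp (by simp) hbm r1 r2 r3 r4 r5 r6 hK hKc,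
    helper_shadow_baseRot_cycleCore g 1 hg norm_one_le_one'' b h3 m hm hbm]

/-- **Sub-goal `helper_eOne_zero_pairings`** (H5-3 of the `e_1`-curve (R-E1CURVE) for node N3a of
NF4): a page loop of `page g 1` whose `x`-coordinate runs on the round four-point circle
`λ (c₀ + R e^{2πiτ})` (`c₀ = eoCenter g`, `R = eoRad g`, `λ = scaleX g 1`) pairs to zero with every
chain vector `chainVec g i`, `i < 2g`, `i ≠ 3`. [cite: FarbMargalit2012, Prop. 6.3] -/
theorem helper_eOne_zero_pairings : ∀ (g : ℕ) (_hg : 2 ≤ g) (K : Metric.sphere (0 : EuclideanSpace ℝ (Fin 2)) 1 → Literature.Topology.FourManifolds.LefschetzBase.Base g) (hK : Continuous K), (∀ θ, K θ ∈ Literature.Topology.FourManifolds.LefschetzBase.page g 1) → (∀ τ : ℝ, Literature.Topology.FourManifolds.LefschetzBase.cx (K (Literature.Topology.FourManifolds.circlePt τ)).1 = Summit.SmoothPoincare4.SmoothPoincare4.Theorems.AcyclicBisectionExists.ModpBraidOrbits.scaleX g 1 * (Summit.SmoothPoincare4.SmoothPoincare4.Theorems.AcyclicBisectionExists.ModpBraidOrbits.eoCenter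 g + Summit.SmoothPoincare4.SmoothPoincare4.Theorems.AcyclicBisectionExists.ModpBraidOrbits.eoRad g * Complex.exp (((2 * Real.pi * τ : ℝ) : ℂ) * Complex.I))) → ∀ (i : ℕ), i < 2 * g → i ≠ 3 → Literature.GroupTheory.CombinatorialGroupTheory.SignedHurwitz.stdSymp ℤ g (Literature.Topology.FourManifolds.LefschetzBase.chainVec g i) (Literature.Topology.FourManifolds.LefschetzBase.shadow g K hK) = 0 := by
  intro g hg K hK hKc hKx i hi hi3
  rw [stdSymp_chainVec_shadow_eq_crossingNumber (by omega) hK hKc hi]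
  exact crossingNumber_model_eoLoop_eq_zero hg hKx (by omega)

end Summit.SmoothPoincare4.SmoothPoincare4.Theorems.AcyclicBisectionExists.ModpBraidOrbits

end
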